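import Summits.BirchSwinnertonDyer.BirchSwinnertonDyer.Theorems.ByReductionTypeAtTwoFineSelmerConjAAtTwoAdditivePotGoodCapitulationCertificate
import Summits.BirchSwinnertonDyer.BirchSwinnertonDyer.Theorems.ByReductionTypeAtTwoFineSelmerConjAAtTwoAdditivePotGoodFukudaRowStampsE
import HarnessLib

/-!
# Route `ByReductionTypeAtTwo` (rung K4), crux C1″ `FineSelmerConjAAtTwoAdditivePotGood` (item stmt-BirchSwinnertonDyer-22615):
# CAPITULATION CERTIFICATE for the census row `194140b1` (cubic `2`-torsion point field of discriminant `-2284`, EVEN class number):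
# the displayed hypothesis `e₁ = e₀` of `conjA_two_194140b1_of_fukudaLayers` DISCHARGED — (A)₂ for `194140b1` modulo `hLim2` ALONE
# (a `--supports 22615` file; seat `bsd-2adic-k4-w1` GEN 7; consumer of `…CapitulationCertificate` and `…ClassGroupCyclicCriterion`)

HONEST FRAMING (cell `bsd-2adic`, D-0036/D-0054/D-0152): a per-class stamp, conditional on `hLim2` (Lim 2017 Thm. 3.5 at `2`) BY NAME and on
nothing else; the former displayed numeric equality `ord₂ h(ℚ(θ, √2)) = ord₂ h(ℚ(θ))` (census/PARI) is now KERNEL. Closes nothing at the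
`∀`-level; nothing booked; BSD is not proved by any of this.

THE CERTIFICATE (`K = ℚ(θ)`, `θ³ + (-2)θ² + (-16)θ + (-18) = 0`, `K₁ = K(s)`, `s² = 2`):
* K-SIDE (`zpowers_mk0_eq_top_d2284n`): `Cl(K) = ⟨[𝔮]⟩` for `𝔮 = (7, θ − 1)` by a pair-witness Minkowski sweep (`…ClassGroupCyclicCriterion`),
  hence `h_K = ord [𝔮]` — no class number is computed;
* L-SIDE (`capitulationIdentity_d2284n`): in ANY commutative ring with `g(B) = 0`, `S² = 2`, the identity
  `(y) · (7, B − 1, s + 3) = (7) · (7, B − 1, s − 3)` for the explicit `y` below (six generator memberships, each a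
  `linear_combination`; found by lattice reduction in `𝓞 K₁`), so the class of `I = (7, θ − 1, s − 3)` — a prime of `K₁` above `𝔮` — is
  `Gal(K₁/K)`-fixed with `N[I] = [𝔮]` (`…CapitulationCertificate`);
* `classNumberPExp_one_eq_zero_layer_d2284n`: the door `classNumberPExp_one_eq_classNumberPExp_zero_of_certificate` (one prime above `2`: Eisenstein model, `existsUnique_two_mem_adjoin_of_eisenstein`).

References: [Fukuda1994] Thm. 1 (1); [Lim2017FineSelmer] Thm. 3.5, Lemma 3.2; [Lang1990] Ch. 13 §4 Lemma 4.1; [Gras2003] II.6.2;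
[Marcus1977] Ch. 5 Thm. 37; [Cohen1993] §6.5.
-/

set_option autoImplicit false
-- sibling precedent (`…FukudaRowStampsE.lean`): the directory name repeats the summit name
set_option linter.dupNamespace false

noncomputable section

open scoped Classical IntermediateField NumberField Real nonZeroDivisors

namespace Summit.BirchSwinnertonDyer.BirchSwinnertonDyer.Theorems.AddKatoTwo

open WeierstrassCurve Field Polynomial IsDedekindDomain NumberField Literature.NumberTheory.EllipticCurves
  Literature.NumberTheory.GaloisRepresentations Literature.NumberTheory.IwasawaTheory Literature.NumberTheory.NumberFields
  Summit.BirchSwinnertonDyer.BirchSwinnertonDyer.Theses.ByReductionTypeAtTwo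

/-! ## §1 K-side: `Cl(K) = ⟨[𝔮]⟩` -/

section KSide

variable (K : Type) [Field K] [NumberField K]

/-- **`Cl(K) = ⟨[𝔮]⟩`, `𝔮 = (7, θ − 1)`, for every cubic number field whose integers contain a root `θ` of
`X³ + (-2)X² + (-16)X + (-18)`** (`|d_K| ≤ 2284`, `M_K < 14`): a pair-witness sweep over the primes `ℓ < 14` in the order
2, 3, 5, 11, 13 — for each root `a` of the cubic mod `ℓ` an element of `(ℓ, θ − a)` of norm `ℓ · m` with `m` supported on
the primes treated before (listed in the proof). Consequently `h_K = ord [𝔮]` (no class number is computed). KERNEL.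
[cite: Marcus1977, Ch. 5 Thm. 37 and the class-group computations after Cor. 2] [cite: Cohen1993, §6.5] -/
theorem zpowers_mk0_eq_top_d2284n (h3 : Module.finrank ℚ K = 3) (b : 𝓞 K)
    (hb : b ^ 3 + (-2 : ℤ) * b ^ 2 + (-16 : ℤ) * b + (-18 : ℤ) = 0)
    (h0 : Ideal.span ({((7 : ℕ) : 𝓞 K), b - ((1 : ℕ) : 𝓞 K)} : Set (𝓞 K)) ∈ (Ideal (𝓞 K))⁰) :
    Subgroup.zpowers (ClassGroup.mk0 ⟨_, h0⟩) = ⊤ := by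
  have hirr := irreducible_cubic_d2284n
  have hd : |NumberField.discr K| ≤ (2284 : ℕ) :=
    le_trans (abs_discr_le_abs_cubic_discr K h3 b hirr hb) (by simp only [Cubic.discr]; norm_num)
  have hM := minkowskiBound_lt_of_sqrt_le K h3 hd (s := 47.80) (B := 14)
    ((Real.sqrt_le_sqrt (by norm_num : ((2284 : ℕ) : ℝ) ≤ (47.80 : ℝ) ^ 2)).trans (Real.sqrt_sq (by norm_num)).le) (by norm_num)
  set H : Subgroup (ClassGroup (𝓞 K)) := Subgroup.zpowers (ClassGroup.mk0 ⟨_, h0⟩) with hH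
  have hq : ClassIn H (Ideal.span ({((7 : ℕ) : 𝓞 K), b - ((1 : ℕ) : 𝓞 K)} : Set (𝓞 K))) := classIn_zpowers_self K _ h0
  have hS0 := forall_prime_above_nil K H
  -- `ℓ = 7`: roots [1], treated primes []
  have h_7 : ∀ P : Ideal (𝓞 K), P.IsPrime → P ≠ ⊥ → ((7 : ℕ) : 𝓞 K) ∈ P → ClassIn H P :=
    classIn_above_of_pairWitnesses K h3 b hirr hb (ℓ := 7) (by norm_num) (S := []) (by decide) hS0 (fun a ha hdvd => by
      interval_cases a <;> norm_num at hdvd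
      · exact Or.inl ⟨by norm_num, hq⟩)
  have hS1 := forall_prime_above_cons K h_7 hS0
  -- `ℓ = 2`: roots [0], treated primes [7]
  have h_2 : ∀ P : Ideal (𝓞 K), P.IsPrime → P ≠ ⊥ → ((2 : ℕ) : 𝓞 K) ∈ P → ClassIn H P :=
    classIn_above_of_pairWitnesses K h3 b hirr hb (ℓ := 2) (by norm_num) (S := [7]) (by decide) hS1 (fun a ha hdvd => by
      interval_cases a <;> norm_num at hdvd
      · exact Or.inr ⟨-2, -1, 0, 1, 1, 0, [], by norm_num, by norm_num, ⟨_, by rw [Nat.cast_one, one_mul]⟩, by norm_num, by decide, by decide⟩)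
  have hS2 := forall_prime_above_cons K h_2 hS1
  -- `ℓ = 3`: roots [0], treated primes [2, 7]
  have h_3 : ∀ P : Ideal (𝓞 K), P.IsPrime → P ≠ ⊥ → ((3 : ℕ) : 𝓞 K) ∈ P → ClassIn H P :=
    classIn_above_of_pairWitnesses K h3 b hirr hb (ℓ := 3) (by norm_num) (S := [2, 7]) (by decide) hS2 (fun a ha hdvd => by
      interval_cases a <;> norm_num at hdvd
      · exact Or.inr ⟨3, 1, -1, 1, 49, 2, [7], by norm_num, by norm_num, ⟨_, by rw [Nat.cast_one, one_mul]⟩, by norm_num, by decide, by decide⟩)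
  have hS3 := forall_prime_above_cons K h_3 hS2
  -- `ℓ = 5`: roots [1, 2, 4], treated primes [3, 2, 7]
  have h_5 : ∀ P : Ideal (𝓞 K), P.IsPrime → P ≠ ⊥ → ((5 : ℕ) : 𝓞 K) ∈ P → ClassIn H P :=
    classIn_above_of_pairWitnesses K h3 b hirr hb (ℓ := 5) (by norm_num) (S := [3, 2, 7]) (by decide) hS3 (fun a ha hdvd => by
      interval_cases a <;> norm_num at hdvd
      · exact Or.inr ⟨1, -1, 0, 1, 7, 1, [7], by norm_num, by norm_num, ⟨_, by rw [Nat.cast_one, one_mul]⟩, by norm_num, by decide, by decide⟩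
      · exact Or.inr ⟨3, 1, 0, 1, 3, 1, [3], by norm_num, by norm_num, ⟨_, by rw [Nat.cast_one, one_mul]⟩, by norm_num, by decide, by decide⟩
      · exact Or.inr ⟨1, 1, 0, 1, 1, 0, [], by norm_num, by norm_num, ⟨_, by rw [Nat.cast_one, one_mul]⟩, by norm_num, by decide, by decide⟩)
  have hS4 := forall_prime_above_cons K h_5 hS3
  -- `ℓ = 11`: roots [], treated primes [5, 3, 2, 7]
  have h_11 : ∀ P : Ideal (𝓞 K), P.IsPrime → P ≠ ⊥ → ((11 : ℕ) : 𝓞 K) ∈ P → ClassIn H P :=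
    classIn_above_of_pairWitnesses K h3 b hirr hb (ℓ := 11) (by norm_num) (S := [5, 3, 2, 7]) (by decide) hS4 (fun a ha hdvd => by
      interval_cases a <;> norm_num at hdvd)
  have hS5 := forall_prime_above_cons K h_11 hS4
  -- `ℓ = 13`: roots [], treated primes [11, 5, 3, 2, 7]
  have h_13 : ∀ P : Ideal (𝓞 K), P.IsPrime → P ≠ ⊥ → ((13 : ℕ) : 𝓞 K) ∈ P → ClassIn H P :=
    classIn_above_of_pairWitnesses K h3 b hirr hb (ℓ := 13) (by norm_num) (S := [11, 5, 3, 2, 7]) (by decide) hS5 (fun a ha hdvd => by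
      interval_cases a <;> norm_num at hdvd)
  have hS6 := forall_prime_above_cons K h_13 hS5
  exact subgroup_eq_top_of_forall_prime_lt K h3 hM (forall_prime_lt_of_forall_mem K (S := [13, 11, 5, 3, 2, 7]) (by decide) hS6)

end KSide

/-! ## §2 L-side: the ideal identity in `𝓞 K₁` -/

/-- **The capitulation identity for `194140b1`**: in any commutative ring with `B³ + (-2)B² + (-16)B + (-18) = 0` and `S² = 2`,
`(y) · (7, B − 1, s + 3) = (7) · (7, B − 1, s − 3)` for the displayed `y` (coefficients found by LLL in the order
`ℤ[θ, s]` of `K₁ = ℚ(θ, √2)`; each membership is a polynomial identity modulo the two relations). KERNEL.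
[cite: Gras2003, II.6.2 (ambiguous ideal classes)] [cite: Cohen2000, §2.3] -/
theorem capitulationIdentity_d2284n {R : Type} [CommRing R] (B S : R)
    (hB : B ^ 3 + ((-2 : ℤ) : R) * B ^ 2 + ((-16 : ℤ) : R) * B + ((-18 : ℤ) : R) = 0) (hS : S ^ 2 = 2) :
    ∃ y : R, (∃ u v w : R, y * ((7 : ℕ) : R) = ((7 : ℕ) : R) * (u * ((7 : ℕ) : R) + v * (B - ((1 : ℕ) : R)) + w * (S - ((3 : ℤ) : R)))) ∧
      (∃ u v w : R, y * (B - ((1 : ℕ) : R)) = ((7 : ℕ) : R) * (u * ((7 : ℕ) : R) + v * (B - ((1 : ℕ) : R)) + w * (S - ((3 : ℤ) : R)))) ∧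
      (∃ u v w : R, y * (S + ((3 : ℤ) : R)) = ((7 : ℕ) : R) * (u * ((7 : ℕ) : R) + v * (B - ((1 : ℕ) : R)) + w * (S - ((3 : ℤ) : R)))) ∧
      (∃ u v w : R, ((7 : ℕ) : R) * ((7 : ℕ) : R) = y * (u * ((7 : ℕ) : R) + v * (B - ((1 : ℕ) : R)) + w * (S + ((3 : ℤ) : R)))) ∧
      (∃ u v w : R, ((7 : ℕ) : R) * (B - ((1 : ℕ) : R)) = y * (u * ((7 : ℕ) : R) + v * (B - ((1 : ℕ) : R)) + w * (S + ((3 : ℤ) : R)))) ∧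
      (∃ u v w : R, ((7 : ℕ) : R) * (S - ((3 : ℤ) : R)) = y * (u * ((7 : ℕ) : R) + v * (B - ((1 : ℕ) : R)) + w * (S + ((3 : ℤ) : R)))) := by
  refine ⟨((-37 : ℤ) : R) + ((24 : ℤ) : R) * S + ((-10 : ℤ) : R) * B + ((1 : ℤ) : R) * B * S + ((3 : ℤ) : R) * B ^ 2 + ((-1 : ℤ) : R) * B ^ 2 * S, ?_, ?_, ?_, ?_, ?_, ?_⟩
  · exact ⟨((-2 : ℤ) : R) + ((1 : ℤ) : R) * B + ((-2 : ℤ) : R) * B * S, ((1 : ℤ) : R) + ((1 : ℤ) : R) * B + ((-1 : ℤ) : R) * B * S + ((-1 : ℤ) : R) * B ^ 2 + ((1 : ℤ) : R) * B ^ 2 * S, ((-2 : ℤ) : R) * S + ((1 : ℤ) : R) * B + ((1 : ℤ) : R) * B * S + ((-1 : ℤ) : R) * B ^ 2, by push_cast; linear_combination (((7 : ℤ) : R) + ((-7 : ℤ) : R) * S) * hB + (((14 : ℤ) : R) + ((-7 : ℤ) : R) * B) * hS⟩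
  · exact ⟨((2 : ℤ) : R) + ((-1 : ℤ) : R) * S, ((1 : ℤ) : R) + ((-1 : ℤ) : R) * S + ((-1 : ℤ) : R) * B, ((-1 : ℤ) : R) * B + ((-1 : ℤ) : R) * B * S, by push_cast; linear_combination (((3 : ℤ) : R) + ((-1 : ℤ) : R) * S) * hB + (((7 : ℤ) : R) * B) * hS⟩
  · exact ⟨((-1 : ℤ) : R), ((-2 : ℤ) : R) * S + ((1 : ℤ) : R) * B, ((-1 : ℤ) : R) * S + ((1 : ℤ) : R) * B, by push_cast; linear_combination (((31 : ℤ) : R) + ((1 : ℤ) : R) * B + ((-1 : ℤ) : R) * B ^ 2) * hS⟩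
  · exact ⟨((1 : ℤ) : R) + ((-1 : ℤ) : R) * S + ((-1 : ℤ) : R) * B * S + ((-1 : ℤ) : R) * B ^ 2, ((-1 : ℤ) : R) + ((-2 : ℤ) : R) * S + ((1 : ℤ) : R) * B + ((-1 : ℤ) : R) * B * S + ((-1 : ℤ) : R) * B ^ 2 + ((1 : ℤ) : R) * B ^ 2 * S, ((-1 : ℤ) : R) + ((1 : ℤ) : R) * B * S + ((1 : ℤ) : R) * B ^ 2 * S, by push_cast; linear_combination (((-29 : ℤ) : R) + ((19 : ℤ) : R) * S + ((9 : ℤ) : R) * B + ((-3 : ℤ) : R) * B * S + ((5 : ℤ) : R) * B ^ 2 + ((-4 : ℤ) : R) * B ^ 2 * S) * hB + (((144 : ℤ) : R) + ((163 : ℤ) : R) * B + ((-24 : ℤ) : R) * B * S + ((22 : ℤ) : R) * B ^ 2 + ((-25 : ℤ) : R) * B ^ 2 * S + ((-23 : ℤ) : R) * B ^ 3 + ((-3 : ℤ) : R) * B ^ 4 + ((1 : ℤ) : R) * B ^ 4 * S + ((1 : ℤ) : R) * B ^ 5) * hS⟩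
  · exact ⟨((1 : ℤ) : R) + ((1 : ℤ) : R) * S + ((1 : ℤ) : R) * B + ((1 : ℤ) : R) * B * S, ((1 : ℤ) : R) * S + ((-1 : ℤ) : R) * B + ((-1 : ℤ) : R) * B ^ 2, ((-1 : ℤ) : R) * B + ((-1 : ℤ) : R) * B ^ 2 + ((1 : ℤ) : R) * B ^ 2 * S, by push_cast; linear_combination (((2 : ℤ) : R) + ((-3 : ℤ) : R) * S + ((3 : ℤ) : R) * B + ((-8 : ℤ) : R) * B * S + ((3 : ℤ) : R) * B ^ 2 + ((-1 : ℤ) : R) * B ^ 2 * S) * hB + (((-144 : ℤ) : R) + ((-174 : ℤ) : R) * B + ((-12 : ℤ) : R) * B ^ 2 + ((-24 : ℤ) : R) * B ^ 2 * S + ((15 : ℤ) : R) * B ^ 3 + ((-1 : ℤ) : R) * B ^ 3 * S + ((-1 : ℤ) : R) * B ^ 4 + ((1 : ℤ) : R) * B ^ 4 * S) * hS⟩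
  · exact ⟨((-1 : ℤ) : R) + ((-1 : ℤ) : R) * S + ((-1 : ℤ) : R) * B + ((-1 : ℤ) : R) * B * S, ((-1 : ℤ) : R) + ((-1 : ℤ) : R) * S + ((1 : ℤ) : R) * B + ((1 : ℤ) : R) * B ^ 2, ((-1 : ℤ) : R) + ((1 : ℤ) : R) * B + ((1 : ℤ) : R) * B ^ 2 + ((-1 : ℤ) : R) * B ^ 2 * S, by push_cast; linear_combination (((1 : ℤ) : R) + ((2 : ℤ) : R) * S + ((-3 : ℤ) : R) * B + ((8 : ℤ) : R) * B * S + ((-3 : ℤ) : R) * B ^ 2 + ((1 : ℤ) : R) * B ^ 2 * S) * hB + (((168 : ℤ) : R) + ((175 : ℤ) : R) * B + ((11 : ℤ) : R) * B ^ 2 + ((24 : ℤ) : R) * B ^ 2 * S + ((-15 : ℤ) : R) * B ^ 3 + ((1 : ℤ) : R) * B ^ 3 * S + ((1 : ℤ) : R) * B ^ 4 + ((-1 : ℤ) : R) * B ^ 4 * S) * hS⟩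

/-! ## §3 The displayed hypothesis `e₁ = e₀` discharged, and the census stamp -/

/-- **`e₁ = e₀` along the cyclotomic `ℤ₂`-tower of `ℚ(θ)`**, `θ` any root of `X³ + (-2)X² + (-16)X + (-18)` — the displayed hypothesis
`h01` of `conjA_two_194140b1_of_fukudaLayers`, now KERNEL: §1 (`h_K = ord [𝔮]`), §2 (the ambiguous class above `𝔮`), and
the door `classNumberPExp_one_eq_classNumberPExp_zero_of_certificate` (one prime above `2`: Eisenstein model, `existsUnique_two_mem_adjoin_of_eisenstein`).
[cite: Lang1990, Ch. 13 §4, Lemma 4.1] [cite: Gras2003, II.6.2.3] [cite: Fukuda1994, Thm. 1 (1), p. 264] -/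
theorem classNumberPExp_one_eq_zero_layer_d2284n {θ : AlgebraicClosure ℚ}
    (hθ : aeval θ (Cubic.toPoly ⟨1, ((-2 : ℤ) : ℚ), ((-16 : ℤ) : ℚ), ((-18 : ℤ) : ℚ)⟩) = 0) :
    haveI : FiniteDimensional ℚ (IntermediateField.adjoin ℚ {θ}) :=
      IntermediateField.adjoin.finiteDimensional ((AlgebraicClosure.isAlgebraic ℚ).isAlgebraic θ).isIntegral
    haveI : NumberField (IntermediateField.adjoin ℚ {θ}) := NumberField.mk
    ∀ κL : ZpExtension (IntermediateField.adjoin ℚ {θ}) 2, κL.IsCyclotomic → classNumberPExp κL 1 = classNumberPExp κL 0 := by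
  haveI : FiniteDimensional ℚ (IntermediateField.adjoin ℚ {θ}) :=
    IntermediateField.adjoin.finiteDimensional ((AlgebraicClosure.isAlgebraic ℚ).isAlgebraic θ).isIntegral
  haveI : NumberField (IntermediateField.adjoin ℚ {θ}) := NumberField.mk
  intro κL hκL
  have hirr := irreducible_cubic_d2284n
  have h3 := finrank_adjoin_eq_three_of_irreducible hirr hθ
  obtain ⟨b, -, hb⟩ := exists_ringOfIntegers_cubic_root (p := -2) (q := -16) (r := -18) hθ
  have hs1 := ncard_primes_above_two_le_one_of_existsUnique (existsUnique_two_mem_adjoin_of_eisenstein (p := -2) (q := -16) (r := -18) (by decide) (by decide) (by decide) (by decide) hθ)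
  have h0 : Ideal.span ({((7 : ℕ) : 𝓞 (IntermediateField.adjoin ℚ {θ})), b - ((1 : ℕ) : 𝓞 (IntermediateField.adjoin ℚ {θ}))} : Set _) ∈
      (Ideal (𝓞 (IntermediateField.adjoin ℚ {θ})))⁰ := by
    refine mem_nonZeroDivisors_of_ne_zero fun h => ?_
    have hmem : ((7 : ℕ) : 𝓞 (IntermediateField.adjoin ℚ {θ})) ∈
        Ideal.span ({((7 : ℕ) : 𝓞 (IntermediateField.adjoin ℚ {θ})), b - ((1 : ℕ) : 𝓞 (IntermediateField.adjoin ℚ {θ}))} : Set _) :=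
      Ideal.subset_span (by simp)
    rw [h] at hmem
    exact absurd (Nat.cast_eq_zero.mp ((Submodule.mem_bot _).mp hmem)) (by norm_num)
  refine classNumberPExp_one_eq_classNumberPExp_zero_of_certificate (by rw [h3]; decide) κL hκL hs1 (n := 7) (by norm_num) h0
      (zpowers_mk0_eq_top_d2284n _ h3 b hb h0) (t := 3) (w := 1) (u := 0) (v := 1) (a := -1) (c := 1)
      (by norm_num) (by norm_num) (by norm_num) ?_
  intro L _ _ _ s hs
  have hB : (algebraMap _ (𝓞 L) b) ^ 3 + ((-2 : ℤ) : 𝓞 L) * (algebraMap _ (𝓞 L) b) ^ 2 +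
      ((-16 : ℤ) : 𝓞 L) * (algebraMap _ (𝓞 L) b) + ((-18 : ℤ) : 𝓞 L) = 0 := by
    simpa only [map_add, map_mul, map_pow, map_intCast, map_zero] using
      congrArg (algebraMap (𝓞 (IntermediateField.adjoin ℚ {θ})) (𝓞 L)) hb
  obtain ⟨y, h1, h2, h3, h4, h5, h6⟩ := capitulationIdentity_d2284n _ s hB hs
  rw [map_sub, map_natCast]
  exact ⟨y, ((7 : ℕ) : 𝓞 L), Nat.cast_ne_zero.mpr (by norm_num), h1, h2, h3, h4, h5, h6⟩

/-- **(A)₂ FOR `194140b1` MODULO `hLim2` ALONE — no displayed datum left.** The Fukuda-row stamp `conjA_two_194140b1_of_fukudaLayers` (k4-w1 GEN 5)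
with its displayed hypothesis `e₁ = e₀` supplied by `classNumberPExp_one_eq_zero_layer_d2284n` (KERNEL: class-group certificate for `ℚ(θ)`,
capitulation certificate in `ℚ(θ, √2)`, Chevalley's ambiguous class number formula, Fukuda 1994 Thm. 1 (1)). Conditional on `hLim2`
(Lim 2017 Thm. 3.5 at `2`) BY NAME; BSD is not proved by this. [cite: Lim2017FineSelmer, §3 Thm. 3.5 and Lemma 3.2]
[cite: Fukuda1994, Thm. 1 (1), p. 264] [cite: Lang1990, Ch. 13 §4, Lemma 4.1] -/
theorem conjA_two_194140b1
    (hLim2 : Lim2017.thm35_at_two_fineSelmerDual_moduleFinite_of_classicalMuVanishes_of_le_divisionField_four)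
    {θ : AlgebraicClosure ℚ} (hθ : aeval θ (Cubic.toPoly ⟨1, ((-2 : ℤ) : ℚ), ((-16 : ℤ) : ℚ), ((-18 : ℤ) : ℚ)⟩) = 0)
    (κ : ZpExtension ℚ 2) (hκ : κ.IsCyclotomic) :
    haveI := isElliptic_194140b1'
    ∃ (γ : absoluteGaloisGroup ℚ) (D : (⟨0, ((-1 : ℤ) : ℚ), 0, ((-3712423301 : ℤ) : ℚ), ((-87062743809199 : ℤ) : ℚ)⟩ : WeierstrassCurve ℚ).FineSelmerDualData κ γ),
      Module.Finite ℤ_[2] (RestrictScalars ℤ_[2] (IwasawaAlgebra 2) D.X) :=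
  conjA_two_194140b1_of_fukudaLayers hLim2 hθ (classNumberPExp_one_eq_zero_layer_d2284n hθ) κ hκ

end Summit.BirchSwinnertonDyer.BirchSwinnertonDyer.Theorems.AddKatoTwo

end
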